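import Summits.CriticalPhenomena.PercolationContinuityZ3.Theorems.Transplant.FKConnectivityAllQForestHubPairDecomposition
import Summits.CriticalPhenomena.PercolationContinuityZ3.Theorems.Transplant.FKConnectivityAllQForestAdjacentCone
import Summits.CriticalPhenomena.PercolationContinuityZ3.Theorems.Transplant.FKConnectivityAllQForestAdjacentCutVertex
import HarnessLib

/-!
# STAR DESCENT: red-join hub-pair positivity (node `HubPairRedJoinOn`, NOT asserted) ⇒ the square-free adjacent forest Rayleigh
# inequality on EVERY TOP FIBRE — by deleting star pairs one at a time from the CONE over the graph

Support file (`--supports stmt-CriticalPhenomena-4575`), FK sub-lane `prim-bschramm-fk-1` (gen 27) of the post-continuity programme;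
builds on p205010 (kernel theorem, internal audit signed; external expert review pending).  Two definitions (one counting predicate, one
`@[conjecture]` node — NOT asserted), no named facts, no sorries; standard axioms.

THE NODE (♣)⁰ = `AdjForestRayleighNoSqOn V`: `bad := #(Fo ∩ {e,f ∈ ω}, Fo) ≤ good := #(Fo ∩ {e ∈ ω}, Fo ∩ {f ∈ ω})` on every fibre, `e = ov`,
`f = oy`; in colouring language `P(e, f same class) ≤ 1/2` for the uniform ordered two-forest colouring `(A, B)`.

NEW NODE — RED-JOIN HUB-PAIR POSITIVITY (RJ) (`HubPairRedJoinOn`; = the literal `A+(s)` of fk-1 g26's two-vertex table, = the sum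
`s_A + s_AB` of g25's hub-pair types): for every fibre, all `o`, `v ≠ y` and every vertex `s`, among the colourings in which `s` lies in
the FIRST-class cluster of `o`: `#(e,f ∈ first) + #(e,f ∈ second) ≤ #(e ∈ first, f ∈ second) + #(f ∈ first, e ∈ second)`, i.e.
`Σ_{(A,B)} χ(e,f)·[s ∈ C_A(o)] ≥ 0` (`χ = +1/−1` for `e, f` in different / equal classes).  Evidence (g26, exact): 0 negatives over all
connected simple graphs with ≤ 9 vertices, every `(o, e, f, s)` (130,920,384 cells at `n = 9`); g27: 0 / 1,100 random instances with
`s ∉ N(o)` and 5–20 vertices (transfer-matrix engine).  It is implied by g25's (★) `HubPairOneClassOn` together with the 'both classes' type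
sum `s_AB ≥ 0` (both 0-negative through `n = 10`), and it is WEAKER than either as a hypothesis in the sense that only their sum is used.

THE DESCENT (memo bschramm/FROM-fk-1-g27-CLUSTER-REPULSION.md §4).  For a pair `h = os ∉ N ∪ u₀` (`s ∉ {o, v, y}`) the one-pair
deletion identities (**`adjForestNoSq_bad_insert_star`**, **`adjForestNoSq_good_insert_star`**)
  `2·bad(N, u₀) = bad(N ∪ {h}, u₀) + [#(Fo ∩ {e,f} ∩ R_os, Fo) + #(Fo ∩ R_os, Fo ∩ {e,f})]`,
  `2·good(N, u₀) = good(N ∪ {h}, u₀) + [#(Fo ∩ {e} ∩ R_os, Fo ∩ {f}) + #(Fo ∩ {f} ∩ R_os, Fo ∩ {e})]`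
(`R_os = {o ~ s}`) show: (RJ) at `s` on `(N, u₀)` AND the node on `(N ∪ {os}, u₀)` ⇒ the node on `(N, u₀)` (**`adjForestNoSq_fibre_of_insert_star`**) —
ADDING a missing star pair at `o` can only help, so the node descends from the fibre in which `o` is joined to EVERY vertex.  On a top fibre
`(Eg, ∅)` that saturated fibre is a CONE with apex `o`, where the node is the kernel theorem `adjForestNoSq_top_of_cone` (fk-1 g22: the
locally-connected theorem) when `v ~ y` in `Eg − o`, and the cut-vertex EQUALITY `adjForestNoSq_fibre_eq_of_cutVertex` (g18) otherwise.  Hence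
**`adjForestNoSq_top_of_redJoin : HubPairRedJoinOn V → (node on every top fibre (Eg, ∅) of V)`** — by induction on the number of
non-neighbours of `o`; in graph language `margin(G') = Σ_{i} 2^{-i}·T_{s_i}(G' + os_1 + ⋯ + os_{i-1}) + 2^{-k}·margin(cone) ≥ 0`.
(The fibre → top-fibre reduction of the node is fk-1 g18's, memo FROM-fk-1-g18-VERTEX-NC.md §1; the descent step itself is proved here for
every fibre.)
[cite: SempleWelsh2008, Conj. 1.1 (p. 2); Thm. 4.2 (p. 11)] [cite: Linusson2011, Prop. 2.6] [cite: Grimmett2006, §1.5 (p. 13)]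
-/

noncomputable section

namespace Summit.CriticalPhenomena.PercolationContinuityZ3.Theorems
namespace FK

open MeasureTheory Set Literature.Probability.LatticeModels Literature.Probability.Percolation
open scoped Classical symmDiff

variable {V : Type*} [Fintype V]

/-! ### The node (RJ) -/

/-- **RED-JOIN HUB-PAIR POSITIVITY (RJ) on the vertex type `V`**: for every fibre `(M, u₀)`, all `o`, `v ≠ y` and every vertex `s`,
among the colourings of the fibre in which `s` is reachable from `o` in the FIRST class `ω`:
`#(e,f ∈ first) + #(e,f ∈ second) ≤ #(e ∈ first, f ∈ second) + #(f ∈ first, e ∈ second)` (`e = ov`, `f = oy`); in colouring language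
`Σ χ(e,f)·[s ∈ C_A(o)] ≥ 0`.  CONJECTURE-SHAPED COUNTING STATEMENT, NOT asserted. [cite: SempleWelsh2008, Conj. 1.1 (p. 2)]
[cite: Linusson2011, Prop. 2.6] -/
def HubPairRedJoinOn (V : Type*) [Fintype V] : Prop :=
  ∀ (M u₀ : BondConfig V), Disjoint u₀ M → ∀ (o v y s : V), v ≠ y →
    fibreCount M u₀ (forestEv V ∩ {ω | s(o, v) ∈ ω ∧ s(o, y) ∈ ω} ∩ reachEv o s) (forestEv V) +
        fibreCount M u₀ (forestEv V ∩ reachEv o s) (forestEv V ∩ {ω | s(o, v) ∈ ω ∧ s(o, y) ∈ ω}) ≤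
      fibreCount M u₀ (forestEv V ∩ {ω | s(o, v) ∈ ω} ∩ reachEv o s) (forestEv V ∩ {ω | s(o, y) ∈ ω}) +
        fibreCount M u₀ (forestEv V ∩ {ω | s(o, y) ∈ ω} ∩ reachEv o s) (forestEv V ∩ {ω | s(o, v) ∈ ω})

/-- **Red-join hub-pair positivity on every finite vertex type.**  CONJECTURE-SHAPED, NOT asserted (evidence in the module docstring:
every connected simple graph with ≤ 9 vertices, every vertex `s`).  Implies the node on every top fibre (`adjForestNoSq_top_of_redJoin`).
[cite: SempleWelsh2008, Conj. 1.1 (p. 2); Thm. 4.2 (p. 11)] -/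
@[conjecture] def HubPairRedJoinPos : Prop := ∀ n : ℕ, HubPairRedJoinOn (Fin n)

/-! ### One star pair inserted: the deletion identities and the descent step -/

section Star

variable {N u₀ : BondConfig V} {o v y s : V}

/-- **Deletion identity for `bad`.**  For `h = os ∉ N ∪ u₀`, `s ∉ {o, v, y}`:
`2·bad(N,u₀) = bad(N ∪ {h}, u₀) + #(Fo ∩ {e,f} ∩ R_os, Fo) + #(Fo ∩ R_os, Fo ∩ {e,f})`. [cite: Linusson2011, Prop. 2.6] [cite: Grimmett2006, §1.5 (p. 13)] -/
theorem adjForestNoSq_bad_insert_star (hos : o ≠ s) (hsv : s ≠ v) (hsy : s ≠ y) (hN : s(o, s) ∉ N) (hu : s(o, s) ∉ u₀) :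
    fibreCount (insert s(o, s) N) u₀ (forestEv V ∩ {ω | s(o, v) ∈ ω ∧ s(o, y) ∈ ω}) (forestEv V) +
        (fibreCount N u₀ (forestEv V ∩ {ω | s(o, v) ∈ ω ∧ s(o, y) ∈ ω} ∩ reachEv o s) (forestEv V) +
          fibreCount N u₀ (forestEv V ∩ reachEv o s) (forestEv V ∩ {ω | s(o, v) ∈ ω ∧ s(o, y) ∈ ω})) =
      2 * fibreCount N u₀ (forestEv V ∩ {ω | s(o, v) ∈ ω ∧ s(o, y) ∈ ω}) (forestEv V) := by
  have hhe : s(o, s) ≠ s(o, v) := fun h' => hsv (Sym2.congr_right.1 h')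
  have hhf : s(o, s) ≠ s(o, y) := fun h' => hsy (Sym2.congr_right.1 h')
  set Pef : Set (BondConfig V) := {ω | s(o, v) ∈ ω ∧ s(o, y) ∈ ω} with hPef
  -- delete `h`
  have hdel : fibreCount (insert s(o, s) N) u₀ (forestEv V ∩ Pef) (forestEv V) =
      fibreCount N u₀ (forestEv V ∩ Pef ∩ (reachEv o s)ᶜ) (forestEv V) +
        fibreCount N u₀ (forestEv V ∩ Pef) (forestEv V ∩ (reachEv o s)ᶜ) := by
    rw [fibreCount_insert_one hN]
    congr 1
    · refine fibreCount_congr_fibre N u₀ fun ω hω => ?_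
      have hno := notMem_and_notMem_symmDiff_of_fibre hN hu hω
      have h1 := insert_mem_forestEv_iff hos hno.1
      constructor
      · rintro ⟨⟨-, hF, he, hf⟩, -, hFB⟩
        have hF' := h1.1 hF
        refine ⟨⟨⟨hF'.1, ?_, ?_⟩, hF'.2⟩, hFB⟩
        · rcases mem_insert_iff.1 he with h' | h'
          · exact absurd h'.symm hhe
          · exact h'
        · rcases mem_insert_iff.1 hf with h' | h'
          · exact absurd h'.symm hhf
          · exact h'
      · rintro ⟨⟨⟨hF, he, hf⟩, hR⟩, hFB⟩
        exact ⟨⟨hno.1, h1.2 ⟨hF, hR⟩, mem_insert_of_mem _ he, mem_insert_of_mem _ hf⟩, hno.2, hFB⟩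
    · refine fibreCount_congr_fibre N u₀ fun ω hω => ?_
      have hno := notMem_and_notMem_symmDiff_of_fibre hN hu hω
      have h2 := insert_mem_forestEv_iff hos hno.2
      constructor
      · rintro ⟨⟨-, hF, hef⟩, -, hFB⟩
        exact ⟨⟨hF, hef⟩, h2.1 hFB⟩
      · rintro ⟨⟨hF, hef⟩, hFB, hR⟩
        exact ⟨⟨hno.1, hF, hef⟩, hno.2, h2.2 ⟨hFB, hR⟩⟩
  -- split `bad(N)` twice
  have hs1 : fibreCount N u₀ (forestEv V ∩ Pef) (forestEv V) =
      fibreCount N u₀ (forestEv V ∩ Pef ∩ reachEv o s) (forestEv V) + fibreCount N u₀ (forestEv V ∩ Pef ∩ (reachEv o s)ᶜ) (forestEv V) := by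
    rw [← fibreCount_split_left N u₀ (forestEv V) (Set.disjoint_left.2 fun ω h₁ h₂ => h₂.2 h₁.2), ← Set.inter_union_distrib_left,
      Set.union_compl_self, Set.inter_univ]
  have hs2 : fibreCount N u₀ (forestEv V ∩ Pef) (forestEv V) =
      fibreCount N u₀ (forestEv V ∩ Pef) (forestEv V ∩ reachEv o s) + fibreCount N u₀ (forestEv V ∩ Pef) (forestEv V ∩ (reachEv o s)ᶜ) := by
    rw [← fibreCount_split_right N u₀ (forestEv V ∩ Pef) (Set.disjoint_left.2 fun ω h₁ h₂ => h₂.2 h₁.2), ← Set.inter_union_distrib_left,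
      Set.union_compl_self, Set.inter_univ]
  have hsw : fibreCount N u₀ (forestEv V ∩ Pef) (forestEv V ∩ reachEv o s) = fibreCount N u₀ (forestEv V ∩ reachEv o s) (forestEv V ∩ Pef) :=
    fibreCount_swap _ _ _ _
  rw [hdel]
  omega

/-- **Deletion identity for `good`.**  For `h = os ∉ N ∪ u₀`, `s ∉ {o, v, y}`:
`2·good(N,u₀) = good(N ∪ {h}, u₀) + #(Fo ∩ {e} ∩ R_os, Fo ∩ {f}) + #(Fo ∩ {f} ∩ R_os, Fo ∩ {e})`. [cite: Linusson2011, Prop. 2.6] [cite: Grimmett2006, §1.5 (p. 13)] -/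
theorem adjForestNoSq_good_insert_star (hos : o ≠ s) (hsv : s ≠ v) (hsy : s ≠ y) (hN : s(o, s) ∉ N) (hu : s(o, s) ∉ u₀) :
    fibreCount (insert s(o, s) N) u₀ (forestEv V ∩ {ω | s(o, v) ∈ ω}) (forestEv V ∩ {ω | s(o, y) ∈ ω}) +
        (fibreCount N u₀ (forestEv V ∩ {ω | s(o, v) ∈ ω} ∩ reachEv o s) (forestEv V ∩ {ω | s(o, y) ∈ ω}) +
          fibreCount N u₀ (forestEv V ∩ {ω | s(o, y) ∈ ω} ∩ reachEv o s) (forestEv V ∩ {ω | s(o, v) ∈ ω})) =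
      2 * fibreCount N u₀ (forestEv V ∩ {ω | s(o, v) ∈ ω}) (forestEv V ∩ {ω | s(o, y) ∈ ω}) := by
  have hhe : s(o, s) ≠ s(o, v) := fun h' => hsv (Sym2.congr_right.1 h')
  have hhf : s(o, s) ≠ s(o, y) := fun h' => hsy (Sym2.congr_right.1 h')
  set Pe : Set (BondConfig V) := {ω | s(o, v) ∈ ω} with hPe
  set Pf : Set (BondConfig V) := {ω | s(o, y) ∈ ω} with hPf
  have hdel : fibreCount (insert s(o, s) N) u₀ (forestEv V ∩ Pe) (forestEv V ∩ Pf) =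
      fibreCount N u₀ (forestEv V ∩ Pe ∩ (reachEv o s)ᶜ) (forestEv V ∩ Pf) +
        fibreCount N u₀ (forestEv V ∩ Pe) (forestEv V ∩ Pf ∩ (reachEv o s)ᶜ) := by
    rw [fibreCount_insert_one hN]
    congr 1
    · refine fibreCount_congr_fibre N u₀ fun ω hω => ?_
      have hno := notMem_and_notMem_symmDiff_of_fibre hN hu hω
      have h1 := insert_mem_forestEv_iff hos hno.1
      constructor
      · rintro ⟨⟨-, hF, he⟩, -, hFB, hf⟩
        have hF' := h1.1 hF
        refine ⟨⟨⟨hF'.1, ?_⟩, hF'.2⟩, hFB, hf⟩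
        rcases mem_insert_iff.1 he with h' | h'
        · exact absurd h'.symm hhe
        · exact h'
      · rintro ⟨⟨⟨hF, he⟩, hR⟩, hFB, hf⟩
        exact ⟨⟨hno.1, h1.2 ⟨hF, hR⟩, mem_insert_of_mem _ he⟩, hno.2, hFB, hf⟩
    · refine fibreCount_congr_fibre N u₀ fun ω hω => ?_
      have hno := notMem_and_notMem_symmDiff_of_fibre hN hu hω
      have h2 := insert_mem_forestEv_iff hos hno.2
      constructor
      · rintro ⟨⟨-, hF, he⟩, -, hFB, hf⟩
        have hFB' := h2.1 hFB
        refine ⟨⟨hF, he⟩, ⟨hFB'.1, ?_⟩, hFB'.2⟩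
        rcases mem_insert_iff.1 hf with h' | h'
        · exact absurd h'.symm hhf
        · exact h'
      · rintro ⟨⟨hF, he⟩, ⟨hFB, hf⟩, hR⟩
        exact ⟨⟨hno.1, hF, he⟩, hno.2, h2.2 ⟨hFB, hR⟩, mem_insert_of_mem _ hf⟩
  have hs1 : fibreCount N u₀ (forestEv V ∩ Pe) (forestEv V ∩ Pf) =
      fibreCount N u₀ (forestEv V ∩ Pe ∩ reachEv o s) (forestEv V ∩ Pf) +
        fibreCount N u₀ (forestEv V ∩ Pe ∩ (reachEv o s)ᶜ) (forestEv V ∩ Pf) := by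
    rw [← fibreCount_split_left N u₀ (forestEv V ∩ Pf) (Set.disjoint_left.2 fun ω h₁ h₂ => h₂.2 h₁.2), ← Set.inter_union_distrib_left,
      Set.union_compl_self, Set.inter_univ]
  have hs2 : fibreCount N u₀ (forestEv V ∩ Pe) (forestEv V ∩ Pf) =
      fibreCount N u₀ (forestEv V ∩ Pe) (forestEv V ∩ Pf ∩ reachEv o s) +
        fibreCount N u₀ (forestEv V ∩ Pe) (forestEv V ∩ Pf ∩ (reachEv o s)ᶜ) := by
    rw [← fibreCount_split_right N u₀ (forestEv V ∩ Pe) (Set.disjoint_left.2 fun ω h₁ h₂ => h₂.2 h₁.2), ← Set.inter_union_distrib_left,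
      Set.union_compl_self, Set.inter_univ]
  have hsw : fibreCount N u₀ (forestEv V ∩ Pe) (forestEv V ∩ Pf ∩ reachEv o s) =
      fibreCount N u₀ (forestEv V ∩ Pf ∩ reachEv o s) (forestEv V ∩ Pe) := fibreCount_swap _ _ _ _
  rw [hdel]
  omega

/-- **THE DESCENT STEP (every fibre).**  If (RJ) holds at the vertex `s` on `(N, u₀)` and the node's inequality holds on the fibre with the
star pair `os` ADDED, `(N ∪ {os}, u₀)` (`os ∉ N ∪ u₀`, `s ∉ {o, v, y}`), then the node's inequality holds on `(N, u₀)`.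
[cite: SempleWelsh2008, Conj. 1.1 (p. 2)] [cite: Linusson2011, Prop. 2.6] -/
theorem adjForestNoSq_fibre_of_insert_star (hos : o ≠ s) (hsv : s ≠ v) (hsy : s ≠ y) (hN : s(o, s) ∉ N) (hu : s(o, s) ∉ u₀)
    (hRJ : fibreCount N u₀ (forestEv V ∩ {ω | s(o, v) ∈ ω ∧ s(o, y) ∈ ω} ∩ reachEv o s) (forestEv V) +
        fibreCount N u₀ (forestEv V ∩ reachEv o s) (forestEv V ∩ {ω | s(o, v) ∈ ω ∧ s(o, y) ∈ ω}) ≤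
      fibreCount N u₀ (forestEv V ∩ {ω | s(o, v) ∈ ω} ∩ reachEv o s) (forestEv V ∩ {ω | s(o, y) ∈ ω}) +
        fibreCount N u₀ (forestEv V ∩ {ω | s(o, y) ∈ ω} ∩ reachEv o s) (forestEv V ∩ {ω | s(o, v) ∈ ω}))
    (hup : fibreCount (insert s(o, s) N) u₀ (forestEv V ∩ {ω | s(o, v) ∈ ω ∧ s(o, y) ∈ ω}) (forestEv V) ≤
      fibreCount (insert s(o, s) N) u₀ (forestEv V ∩ {ω | s(o, v) ∈ ω}) (forestEv V ∩ {ω | s(o, y) ∈ ω})) :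
    fibreCount N u₀ (forestEv V ∩ {ω | s(o, v) ∈ ω ∧ s(o, y) ∈ ω}) (forestEv V) ≤
      fibreCount N u₀ (forestEv V ∩ {ω | s(o, v) ∈ ω}) (forestEv V ∩ {ω | s(o, y) ∈ ω}) := by
  have hb := adjForestNoSq_bad_insert_star (u₀ := u₀) (N := N) hos hsv hsy hN hu (v := v) (y := y)
  have hg := adjForestNoSq_good_insert_star (u₀ := u₀) (N := N) hos hsv hsy hN hu (v := v) (y := y)
  omega

end Star

/-! ### Top fibres: descent from the cone -/

section Top

variable {Eg : BondConfig V} {o v y : V}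

/-- **Base of the descent: `o` joined to every vertex.**  On a top fibre `(Eg, ∅)` in which `s(o, w) ∈ Eg` for every `w ≠ o`, the node's
inequality holds at `(o; v, y)` (`v ≠ y`): by the cone theorem if `v ~ y` in `Eg − o`, by the cut-vertex equality otherwise.
[cite: SempleWelsh2008, Conj. 1.1 (p. 2)] [cite: Linusson2011, Prop. 2.6] [cite: Grimmett2006, §3.8 (pp. 61–62)] -/
theorem adjForestNoSq_top_of_universal (huniv : ∀ w, w ≠ o → s(o, w) ∈ Eg) (hvy : v ≠ y) (hov : o ≠ v) (hoy : o ≠ y) :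
    fibreCount Eg ∅ (forestEv V ∩ {ω | s(o, v) ∈ ω ∧ s(o, y) ∈ ω}) (forestEv V) ≤
      fibreCount Eg ∅ (forestEv V ∩ {ω | s(o, v) ∈ ω}) (forestEv V ∩ {ω | s(o, y) ∈ ω}) := by
  have he : s(o, v) ∈ Eg := huniv v hov.symm
  have hf : s(o, y) ∈ Eg := huniv y hoy.symm
  by_cases hconn : (openGraph {g ∈ Eg | o ∉ g}).Reachable v y
  · exact adjForestNoSq_top_of_cone huniv he hf hvy hov hoy hconn
  · -- `o` is a cut vertex separating `v` from `y`: equality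
    set V₁ : Set V := {w | w = o ∨ (openGraph {g ∈ Eg | o ∉ g}).Reachable v w} with hV₁
    set V₂ : Set V := {w | w = o ∨ ¬ (openGraph {g ∈ Eg | o ∉ g}).Reachable v w} with hV₂
    set E₁ : BondConfig V := {g ∈ Eg | ∀ z ∈ g, z ∈ V₁} with hE₁
    set E₂ : BondConfig V := Eg \ E₁ with hE₂
    set M : BondConfig V := Eg \ {s(o, v), s(o, y)} with hM
    have hEg : Eg = insert s(o, y) (insert s(o, v) M) := by
      ext g
      simp only [hM, mem_insert_iff, mem_sdiff, mem_singleton_iff, not_or]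
      constructor
      · intro hg
        by_cases h1 : g = s(o, y)
        · exact Or.inl h1
        · by_cases h2 : g = s(o, v)
          · exact Or.inr (Or.inl h2)
          · exact Or.inr (Or.inr ⟨hg, h2, h1⟩)
      · rintro (rfl | rfl | ⟨hg, -, -⟩)
        · exact hf
        · exact he
        · exact hg
    have h₁ : ∀ g ∈ E₁, ∀ z ∈ g, z ∈ V₁ := fun g hg => hg.2
    have h₂ : ∀ g ∈ E₂, ∀ z ∈ g, z ∈ V₂ := by
      intro g hg z hz
      obtain ⟨hgE, hgn⟩ := hg
      by_cases hzo : z = o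
      · exact Or.inl hzo
      · right
        intro hvz
        apply hgn
        refine ⟨hgE, fun z' hz' => ?_⟩
        by_cases hz'o : z' = o
        · exact Or.inl hz'o
        · right
          by_cases hzz : z = z'
          · rw [← hzz]; exact hvz
          · -- `g = s(z, z')` avoids `o`, so it is an edge of `Eg − o`
            have hgzz : g = s(z, z') := (Sym2.mem_and_mem_iff hzz).1 ⟨hz, hz'⟩
            have hog : o ∉ g := by
              rw [hgzz]; intro ho
              rcases Sym2.mem_iff.1 ho with h' | h'
              · exact hzo h'.symm
              · exact hz'o h'.symm
            have hmem : s(z, z') ∈ ({g ∈ Eg | o ∉ g} : Set (Sym2 V)) := ⟨hgzz ▸ hgE, hgzz ▸ hog⟩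
            exact hvz.trans ((openGraph_adj _ _ _).2 ⟨hmem, hzz⟩).reachable
    have hS : V₁ ∩ V₂ ⊆ {o} := by
      rintro w ⟨hw₁, hw₂⟩
      rcases hw₁ with hw₁ | hw₁
      · exact hw₁
      · rcases hw₂ with hw₂ | hw₂
        · exact hw₂
        · exact absurd hw₁ hw₂
    have hd : Disjoint E₁ E₂ := Set.disjoint_sdiff_right
    have heE : s(o, v) ∈ E₁ := by
      refine ⟨he, fun z hz => ?_⟩
      rcases Sym2.mem_iff.1 hz with rfl | rfl
      · exact Or.inl rfl
      · exact Or.inr (SimpleGraph.Reachable.refl _)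
    have hfE : s(o, y) ∈ E₂ := by
      refine ⟨hf, fun hf1 => ?_⟩
      rcases hf1.2 y (Sym2.mem_mk_right _ _) with hyo | hvy'
      · exact hoy hyo.symm
      · exact hconn hvy'
    have hsub : insert s(o, y) (insert s(o, v) M) ∪ (∅ : BondConfig V) ⊆ E₁ ∪ E₂ := by
      rw [union_empty, ← hEg, hE₂, Set.union_sdiff_self]
      exact subset_union_right
    rw [hEg]
    exact (adjForestNoSq_fibre_eq_of_cutVertex h₁ h₂ hS hd heE hfE hsub).le

/-- **RED-JOIN HUB-PAIR POSITIVITY ⇒ THE NODE ON EVERY TOP FIBRE** (descent from the cone, by induction on the number of non-neighbours of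
`o`): if `HubPairRedJoinOn V` then `#(Fo ∩ {ov, oy ∈ ω}, Fo) ≤ #(Fo ∩ {ov ∈ ω}, Fo ∩ {oy ∈ ω})` on `(Eg, ∅)` for every pair set `Eg` on `V`
and all `o`, `v ≠ y`. [cite: SempleWelsh2008, Conj. 1.1 (p. 2); Thm. 4.2 (p. 11)] [cite: Linusson2011, Prop. 2.6] [cite: Grimmett2006, §1.5 (p. 13)] -/
theorem adjForestNoSq_top_of_redJoin (h : HubPairRedJoinOn V) (Eg : BondConfig V) (o : V) {v y : V} (hvy : v ≠ y) :
    fibreCount Eg ∅ (forestEv V ∩ {ω | s(o, v) ∈ ω ∧ s(o, y) ∈ ω}) (forestEv V) ≤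
      fibreCount Eg ∅ (forestEv V ∩ {ω | s(o, v) ∈ ω}) (forestEv V ∩ {ω | s(o, y) ∈ ω}) := by
  -- degenerate placements
  by_cases hov : o = v
  · subst hov
    rw [fibreCount_eq_zero_of_forall _ _ _ _ fun ω _ hA _ => hA.1.1 _ hA.2.1 (Sym2.mk_isDiag_iff.2 rfl)]
    exact Nat.zero_le _
  by_cases hoy : o = y
  · subst hoy
    rw [fibreCount_eq_zero_of_forall _ _ _ _ fun ω _ hA _ => hA.1.1 _ hA.2.2 (Sym2.mk_isDiag_iff.2 rfl)]
    exact Nat.zero_le _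
  by_cases he : s(o, v) ∈ Eg
  swap
  · rw [adjForestNoSq_bad_eq_zero_of_notMem he (notMem_empty _)]; exact Nat.zero_le _
  by_cases hf : s(o, y) ∈ Eg
  swap
  · rw [adjForestNoSq_bad_eq_zero_of_notMem' hf (notMem_empty _)]; exact Nat.zero_le _
  -- induction on the number of non-neighbours of `o`
  suffices H : ∀ (k : ℕ) (E : BondConfig V), s(o, v) ∈ E → s(o, y) ∈ E →
      ({w : V | w ≠ o ∧ s(o, w) ∉ E} : Set V).ncard = k →
      fibreCount E ∅ (forestEv V ∩ {ω | s(o, v) ∈ ω ∧ s(o, y) ∈ ω}) (forestEv V) ≤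
        fibreCount E ∅ (forestEv V ∩ {ω | s(o, v) ∈ ω}) (forestEv V ∩ {ω | s(o, y) ∈ ω}) from
    H _ Eg he hf rfl
  intro k
  induction k with
  | zero =>
    intro E heE hfE hk
    refine adjForestNoSq_top_of_universal (fun w hw => ?_) hvy hov hoy
    by_contra hnot
    have hmem : w ∈ ({w : V | w ≠ o ∧ s(o, w) ∉ E} : Set V) := ⟨hw, hnot⟩
    rw [(Set.ncard_eq_zero (Set.toFinite _)).1 hk] at hmem
    exact hmem
  | succ k ih =>
    intro E heE hfE hk
    -- pick a non-neighbour `s`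
    obtain ⟨s, hso, hsE⟩ : ({w : V | w ≠ o ∧ s(o, w) ∉ E} : Set V).Nonempty :=
      Set.nonempty_of_ncard_ne_zero (by rw [hk]; exact Nat.succ_ne_zero k)
    have hsv : s ≠ v := fun h' => hsE (h' ▸ heE)
    have hsy : s ≠ y := fun h' => hsE (h' ▸ hfE)
    -- the fibre with `os` added has one non-neighbour fewer
    have hcard : ({w : V | w ≠ o ∧ s(o, w) ∉ insert s(o, s) E} : Set V).ncard = k := by
      have hsub : ({w : V | w ≠ o ∧ s(o, w) ∉ insert s(o, s) E} : Set V) = {w : V | w ≠ o ∧ s(o, w) ∉ E} \ {s} := by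
        ext w
        simp only [mem_setOf_eq, mem_sdiff, mem_singleton_iff, mem_insert_iff, not_or]
        constructor
        · rintro ⟨hwo, hws, hwE⟩
          exact ⟨⟨hwo, hwE⟩, fun hws' => hws (by rw [hws'])⟩
        · rintro ⟨⟨hwo, hwE⟩, hws⟩
          exact ⟨hwo, fun h' => hws (Sym2.congr_right.1 h'), hwE⟩
      rw [hsub, Set.ncard_sdiff_singleton_of_mem (show s ∈ ({w : V | w ≠ o ∧ s(o, w) ∉ E} : Set V) from ⟨hso, hsE⟩), hk]
      rfl
    have hup := ih (insert s(o, s) E) (mem_insert_of_mem _ heE) (mem_insert_of_mem _ hfE) hcard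
    exact adjForestNoSq_fibre_of_insert_star hso.symm hsv hsy hsE (notMem_empty _)
      (h E ∅ (Set.empty_disjoint _) o v y s hvy) hup

end Top


/-! ### Local forms of the descent: one common neighbour, one path -/

section Local

variable {Eg : BondConfig V} {o v y w : V}

/-- **(♣)⁰ FROM ONE RED-JOIN INEQUALITY AT A COMMON NEIGHBOUR.**  Top fibre `(Eg, ∅)`, `e = ov`, `f = oy ∈ Eg`, `v ≠ y`, and a vertex `w ∉ {o, v, y}` with
`vw, wy ∈ Eg`, `ow ∉ Eg`.  If (RJ) holds at `(o; v, y; w)` on `(Eg, ∅)` — `Σ χ(e,f)[w ∈ C_A(o)] ≥ 0`, ONE inequality — then the node's inequality holds on `(Eg, ∅)`: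
add the star pair `ow` (descent step) and use the fan `v – w – y` in the link of `o` (g22's locally-connected theorem).
[cite: SempleWelsh2008, Conj. 1.1 (p. 2)] [cite: Linusson2011, Prop. 2.6] [cite: Grimmett2006, §1.5 (p. 13)] -/
theorem adjForestNoSq_top_of_commonNeighbour (he : s(o, v) ∈ Eg) (hf : s(o, y) ∈ Eg) (hvw : s(v, w) ∈ Eg) (hwy : s(w, y) ∈ Eg)
    (how : s(o, w) ∉ Eg) (hvy : v ≠ y) (hov : o ≠ v) (hoy : o ≠ y) (hwo : w ≠ o) (hwv : w ≠ v) (hwy' : w ≠ y)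
    (hRJ : fibreCount Eg ∅ (forestEv V ∩ {ω | s(o, v) ∈ ω ∧ s(o, y) ∈ ω} ∩ reachEv o w) (forestEv V) +
        fibreCount Eg ∅ (forestEv V ∩ reachEv o w) (forestEv V ∩ {ω | s(o, v) ∈ ω ∧ s(o, y) ∈ ω}) ≤
      fibreCount Eg ∅ (forestEv V ∩ {ω | s(o, v) ∈ ω} ∩ reachEv o w) (forestEv V ∩ {ω | s(o, y) ∈ ω}) +
        fibreCount Eg ∅ (forestEv V ∩ {ω | s(o, y) ∈ ω} ∩ reachEv o w) (forestEv V ∩ {ω | s(o, v) ∈ ω})) :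
    fibreCount Eg ∅ (forestEv V ∩ {ω | s(o, v) ∈ ω ∧ s(o, y) ∈ ω}) (forestEv V) ≤
      fibreCount Eg ∅ (forestEv V ∩ {ω | s(o, v) ∈ ω}) (forestEv V ∩ {ω | s(o, y) ∈ ω}) := by
  refine adjForestNoSq_fibre_of_insert_star hwo.symm hwv hwy' how (notMem_empty _) hRJ ?_
  -- the fan `v – w – y` in the link of `o` in `Eg ∪ {ow}`
  refine adjForestNoSq_top_of_linkReachable (insert s(o, w) Eg) hvy ?_
  have hlink : ∀ {a b : V}, s(a, b) ∈ Eg → a ≠ o → b ≠ o → a ≠ b → s(o, a) ∈ insert s(o, w) Eg → s(o, b) ∈ insert s(o, w) Eg →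
      (openGraph {g ∈ insert s(o, w) Eg | ∀ z ∈ g, z ≠ o ∧ s(o, z) ∈ insert s(o, w) Eg}).Adj a b := by
    intro a b hab hao hbo hne hoa hob
    refine (openGraph_adj _ _ _).2 ⟨⟨mem_insert_of_mem _ hab, fun z hz => ?_⟩, hne⟩
    rcases Sym2.mem_iff.1 hz with rfl | rfl
    · exact ⟨hao, hoa⟩
    · exact ⟨hbo, hob⟩
  have h1 := hlink hvw hov.symm hwo hwv.symm (mem_insert_of_mem _ he) (mem_insert _ _)
  have h2 := hlink hwy hwo hoy.symm hwy' (mem_insert _ _) (mem_insert_of_mem _ hf)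
  exact h1.reachable.trans h2.reachable

end Local

end FK
end Summit.CriticalPhenomena.PercolationContinuityZ3.Theorems

end
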